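import Literature.InformationTheory.Entanglement.SpinSqueezingCriterion
import Mathlib.Algebra.Star.BigOperators
import HarnessLib

/-!
# `(ΔJ_x)² + (ΔJ_y)² + (ΔJ_z)² ≥ M/2` for states with `M` spins unentangled from the rest

Topic `Literature/InformationTheory/Entanglement`, continuation of `SpinSqueezingCriterion.lean`
(register `Fin N → Bool`, `collectiveSpin l N = J_l`, `variance`, `varianceT`, `productVec`,
`bloch`, `IsSeparable`) and of the cut formalism of `GHZFidelityWitness.lean` (`tensorAcross A a b`).
Sources (held texts, read at the cited places):

* O. Gühne, G. Tóth, *Entanglement detection*, Phys. Rep. 474, 1 (2009) = arXiv:0811.2803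
  [GuhneToth2009], §8.1.2 (after the singlet criterion (195)): “In addition, the violation of the
  criterion gives information about the number of spins that are unentangled with the rest
  [502, 504]: Let us consider a pure state for which the first `M` qubits are not entangled with
  other qubits while the rest of the qubits are entangled with each other
  `|Ψ⟩ = (⊗_{k=1}^M |ψ_k⟩) ⊗ |ψ⟩_{M+1,…,N}`. For such a state, based on the theory of entanglement
  detection with uncertainties, one has [108] **`(ΔJ_x)² + (ΔJ_y)² + (ΔJ_z)² ≥ M/2`** (196). If a
  mixed state `ϱ := Σ_k p_k|Ψ_k⟩⟨Ψ_k|` violates Eq. (196) then at least one of the components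
  `|Ψ_k⟩⟨Ψ_k|` must have `M` or more spins that are entangled with other spins. If the left-hand
  side of Eq. (196) is smaller than `½` then the state cannot be created by mixing states that have
  one or more unentangled spins”; [108] = O. Gühne, PRL 92, 117903 (2004), [502] = Tóth, Knapp,
  Gühne, Briegel (2008), [504] = Tóth, PRA 71, 010301 (2005) — cited through the review.
* G. Tóth, *Entanglement witnesses in spin models*, Phys. Rev. A 71, 010301(R) (2005) =
  arXiv:quant-ph/0406061 [Toth2005SpinModelWitnesses], the paragraph on `H_S := J_x² + J_y² + J_z²`
  (there `J_l = Σ_k σ_l^{(k)}` without the `½`): “Based on the previous considerations, it can be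
  proved that for pure states `⟨H_S⟩/2` is an upper bound for the number of unentangled spins,
  `N_u`. For mixed states of the form `ρ = Σ_k p_k|Φ_k⟩⟨Φ_k|` we obtain `⟨H_S⟩/2 ≥ Σ_k p_k N_{u,k}`.”

HONEST FRAMING (pub-qadeq lane — ‘macroscopic singlet’ / ‘all `N` atoms entangled’ readings of
collective-spin variances in cold-atom and solid-state ensembles): instance-level adjudication of
specific advantage claims; no claim about BQP vs BPP or the summit.  This file proves the bound for
qubit registers with an explicitly given unentangled block; estimation statistics, particle-number
fluctuations and bosonic symmetry are not addressed.

## The proof (the local-uncertainty-relation argument the review points to)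

Write `2J_l = P_l + Q_l` with `P_l = Σ_{i∈A} σ_l^{(i)}` (the unentangled block `A`, `|A| = M`) and
`Q_l = Σ_{i∉A} σ_l^{(i)}` (the rest).  In `|Ψ⟩ = (⊗_{k∈A}|φ_k⟩) ⊗ |b⟩`: (i) `⟨P_lQ_l⟩ = ⟨P_l⟩⟨Q_l⟩`
(no correlations across a product cut), so `4(ΔJ_l)² = (ΔP_l)² + (ΔQ_l)²`; (ii) `(ΔQ_l)² ≥ 0`;
(iii) `⟨P_l⟩`, `⟨P_l²⟩` do not depend on `b`, hence equal their values in the fully separable state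
`⊗_{k}|φ_k⟩`, where `(ΔP_l)² = Σ_{i∈A}(1 − l_i²)` with `l_i = ⟨φ_i|σ_l|φ_i⟩`
(`SpinSqueezingCriterion.expect_localPauli_mul`); (iv) `Σ_l Σ_{i∈A}(1 − l_i²) = 2M` by
`x_i² + y_i² + z_i² = 1`.  Hence `Σ_l (ΔJ_l)² = M/2 + ¼Σ_l (ΔQ_l)² ≥ M/2`; concavity of the variance
(`varianceT_mixture_ge`) gives the mixed-state form.

## Contents (all proved, 0 named facts)

* Pauli strings on any finite register: `pauliWordOn w` (`pauliWord = pauliWordOn` on `Fin N`),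
  `pauliWordOn_const_I` (`= 𝟙`), `pauliWordOn_isHermitian`, `star_dotProduct_pauliWordOn_mulVec`
  (`⟨φ, Wχ⟩ = ⟨Wφ, χ⟩`), `star_dotProduct_mulVec_of_isHermitian` (expectations of Hermitian matrices
  are real), `star_prodVec_dotProduct`.
* **Cut calculus** (reusable for every file built on `tensorAcross`):
  **`star_tensorAcross_dotProduct`** (`⟨a⊗b, a'⊗b'⟩ = ⟨a,a'⟩⟨b,b'⟩`),
  **`pauliWord_mulVec_tensorAcross`** (`(⊗_jσ_{w_j})(a⊗b) = (W_A a) ⊗ (W_Ā b)`),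
  `pauliWordOn_out_eq_one` / `pauliWordOn_in_eq_one` (words supported on one side), and the three
  expectation rules `dot_word_in` (`⟨a⊗b, V(a⊗b)⟩ = ⟨a, V_A a⟩`), `dot_word_in_in`, and
  **`dot_word_in_out`** / `dot_word_out_in` (`⟨V W⟩ = ⟨V⟩⟨W⟩` for `V` on `A`, `W` on `Ā`).
* Block states: **`blockState A φ b = (⊗_{k∈A}|φ_k⟩) ⊗ |b⟩_Ā`**, `productVec_eq_blockState`,
  `spinIn A l = Σ_{i∈A}σ_l^{(i)}`, `spinOut A l = Σ_{i∉A}σ_l^{(i)}`, `collectiveSpin_eq`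
  (`J_l = ½(spinIn + spinOut)`), Hermiticity, `blockState_norm`.
* The LUR steps: `dot_spinIn_eq`, `dot_spinIn_sq_eq` ((iii)), **`dot_spinIn_spinOut`** /
  `dot_spinOut_spinIn` ((i)), `vecState_spinIn_productVec`, `vecState_spinIn_sq_productVec`,
  **`variance_collectiveSpin_blockState`** (`(ΔJ_l)² = ¼Σ_{i∈A}(1 − l_i²) + ¼(ΔQ_l)²`),
  `varianceOut_nonneg` ((ii)), `variance_collectiveSpin_blockState_ge`.
* **Eq. (196)**: **`sum_variance_blockState_ge`** (`Σ_l (ΔJ_l)² ≥ |A|/2`), the exact excess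
  **`sum_variance_blockState_eq`** (`= |A|/2 + ¼Σ_l(ΔQ_l)²`), `HasUnentangledBlock A ψ`,
  `HasUnentangledBlock.sum_variance_ge`; mixtures: **`sum_varianceT_mixture_ge`**
  (`Σ_l(ΔJ_l)²_ϱ ≥ Σ_k p_k|A_k|/2`, Tóth 2005's `⟨H_S⟩/2 ≥ Σ_k p_k N_{u,k}`),
  **`sum_varianceT_mixture_ge_of_card`** (`≥ M/2` when every component has `≥ M` unentangled
  spins), and the detection statement **`exists_block_lt_of_sum_varianceT_lt`** (if
  `Σ_l(ΔJ_l)²_ϱ < M/2` then some component with `p_k > 0` has fewer than `M` unentangled spins —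
  for `M = 1`: “cannot be created by mixing states that have one or more unentangled spins”).

NOT formalised: the converse / optimality of `M/2`, the maximisation over all decompositions of a
given `ϱ` (we quantify over a given decomposition), spin-`j > ½` ensembles, and the symmetric-state
refinements [501].

## Mathlib / tree search

Nothing on local uncertainty relations in Mathlib; tree: `SpinSqueezingCriterion.lean` (this
vocabulary; eq. (194), (195), (197)), `CollectiveSpinVarianceBound.lean` (`Z`-diagonal QFI bounds),
`TsirelsonBound.lean` (`vecState`, `IsPosFunctional.sq_le_one_mul` = “non-negative variance”, used
for step (ii)).  Reused from Mathlib: `Equiv.piEquivPiSubtypeProd`, `Finset.prod_mul_prod_compl`,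
`Finset.sum_add_sum_compl`, `isSelfAdjoint_sum`, `Matrix.sum_mulVec`, `Matrix.mulVec_sum`.
-/

noncomputable section

open scoped BigOperators ComplexOrder
open Matrix Complex Finset
open Literature.Computability.QuantumComplexity
open Literature.InformationTheory.Entanglement.Tsirelson

namespace Literature.InformationTheory.Entanglement

namespace UnentangledSpins

open GHZWitness MerminKlyshkoGHZ SpinSqueezing

variable {N : ℕ}

/-! ## Pauli words on an arbitrary finite register -/

section Generic

variable {ι : Type*} [Fintype ι] [DecidableEq ι]

/-- A Pauli string `⊗_{j ∈ ι} σ_{w_j}` on the register `ι → Bool` (entries = products of the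
one-qubit entries; `pauliWord` of `MerminKlyshkoGHZ.lean` is the case `ι = Fin N`).
[cite: GuhneToth2009, §8.1 (local operators `σ_l^{(k)}`)] -/
def pauliWordOn (w : ι → Pauli) : Matrix (ι → Bool) (ι → Bool) ℂ :=
  Matrix.of fun x y => ∏ j, (w j).mat (x j) (y j)

omit [DecidableEq ι] in
/-- Unfolding `pauliWordOn`. [cite: GuhneToth2009, §8.1] -/
theorem pauliWordOn_apply (w : ι → Pauli) (x y : ι → Bool) :
    pauliWordOn w x y = ∏ j, (w j).mat (x j) (y j) := rfl

omit [DecidableEq ι] in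
/-- The empty word is the identity: `⊗_j 𝟙 = 𝟙`. [cite: GuhneToth2009, §8.1] -/
theorem pauliWordOn_const_I : pauliWordOn (fun _ : ι => Pauli.I) = 1 := by
  ext x y
  rw [pauliWordOn_apply, Matrix.one_apply]
  by_cases h : x = y
  · subst h
    rw [if_pos rfl]
    exact Finset.prod_eq_one fun j _ => by simp
  · rw [if_neg h]
    obtain ⟨j, hj⟩ : ∃ j, x j ≠ y j := by
      by_contra hc
      push Not at hc
      exact h (funext hc)
    exact Finset.prod_eq_zero (Finset.mem_univ j) (by simp [hj])

omit [DecidableEq ι] in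
/-- A Pauli string is Hermitian. [cite: GuhneToth2009, §8.1] -/
theorem pauliWordOn_isHermitian (w : ι → Pauli) : (pauliWordOn w).IsHermitian := by
  refine Matrix.IsHermitian.ext fun x y => ?_
  rw [pauliWordOn_apply, pauliWordOn_apply, star_prod]
  refine Finset.prod_congr rfl fun j _ => ?_
  have h := congrFun (congrFun (Pauli.conjTranspose_mat (w j)) (x j)) (y j)
  rw [conjTranspose_apply] at h
  exact h

/-- `⟨φ, Wχ⟩ = ⟨Wφ, χ⟩` for a (Hermitian) Pauli string. [cite: GuhneToth2009, §8.1] -/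
theorem star_dotProduct_pauliWordOn_mulVec (w : ι → Pauli) (φ χ : (ι → Bool) → ℂ) :
    star φ ⬝ᵥ (pauliWordOn w *ᵥ χ) = star (pauliWordOn w *ᵥ φ) ⬝ᵥ χ := by
  rw [← star_dotProduct_conjTranspose_mulVec, (pauliWordOn_isHermitian w).eq]

/-- Expectations of Hermitian matrices are real: `⟨ψ, Mψ⟩ = Re⟨ψ, Mψ⟩`.
[cite: GuhneToth2009, §8.1] -/
theorem star_dotProduct_mulVec_of_isHermitian {κ : Type*} [Fintype κ] {M : Matrix κ κ ℂ}
    (hM : M.IsHermitian) (ψ : κ → ℂ) :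
    star ψ ⬝ᵥ (M *ᵥ ψ) = ((star ψ ⬝ᵥ (M *ᵥ ψ)).re : ℂ) := by
  have h : star (star ψ ⬝ᵥ (M *ᵥ ψ)) = star ψ ⬝ᵥ (M *ᵥ ψ) := by
    rw [← star_dotProduct, ← star_dotProduct_conjTranspose_mulVec, hM.eq]
  have h' : (starRingEnd ℂ) (star ψ ⬝ᵥ (M *ᵥ ψ)) = star ψ ⬝ᵥ (M *ᵥ ψ) := by
    simpa [Complex.star_def] using h
  exact ((Complex.conj_eq_iff_re).1 h').symm

/-- Inner products of product amplitudes factorise over the qubits of any register: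
`⟨⊗φ_i, ⊗χ_i⟩ = Π_i ⟨φ_i, χ_i⟩`. [cite: GuhneToth2009, §8.1] -/
theorem star_prodVec_dotProduct (φ χ : ι → Bool → ℂ) :
    star (fun u : ι → Bool => ∏ i, φ i (u i)) ⬝ᵥ (fun u => ∏ i, χ i (u i)) =
      ∏ i, (star (φ i) ⬝ᵥ χ i) := by
  simp only [dotProduct, Pi.star_apply, star_prod]
  rw [Fintype.prod_sum]
  refine Finset.sum_congr rfl fun x _ => ?_
  rw [← Finset.prod_mul_distrib]

end Generic

/-- `pauliWord` is `pauliWordOn` on the register `Fin N → Bool`. [cite: GuhneToth2009, §8.1] -/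
theorem pauliWord_eq_pauliWordOn (w : Fin N → Pauli) : pauliWord w = pauliWordOn w := rfl

/-! ## Product states across a cut: factorisation of Pauli strings and of inner products -/

section Cut

variable (A : Finset (Fin N))

/-- **Inner products factorise across a cut**: `⟨a ⊗ b, a' ⊗ b'⟩ = ⟨a, a'⟩·⟨b, b'⟩`.
[cite: GuhneToth2009, §8.1.2 eq. (196) (the state `(⊗_{k=1}^M |ψ_k⟩) ⊗ |ψ⟩_{M+1,…,N}`)] -/
theorem star_tensorAcross_dotProduct (a a' : ({i // i ∈ A} → Bool) → ℂ)
    (b b' : ({i // i ∉ A} → Bool) → ℂ) :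
    star (tensorAcross A a b) ⬝ᵥ tensorAcross A a' b' = (star a ⬝ᵥ a') * (star b ⬝ᵥ b') := by
  let e := Equiv.piEquivPiSubtypeProd (fun i : Fin N => i ∈ A) (fun _ => Bool)
  have h1 : ∀ x, (e x).1 = restrictIn A x := fun x => rfl
  have h2 : ∀ x, (e x).2 = restrictOut A x := fun x => rfl
  rw [dotProduct, dotProduct, dotProduct, Finset.sum_mul_sum, ← Fintype.sum_prod_type']
  refine Fintype.sum_equiv e _ _ fun x => ?_
  rw [Pi.star_apply, tensorAcross_apply, tensorAcross_apply, star_mul', h1, h2]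
  simp only [Pi.star_apply]
  ring

/-- **Pauli strings act factorwise across a cut**:
`(⊗_j σ_{w_j})(a ⊗ b) = ((⊗_{j∈A} σ_{w_j}) a) ⊗ ((⊗_{j∉A} σ_{w_j}) b)`.
[cite: GuhneToth2009, §8.1 (local operators) with §8.1.2 eq. (196)] -/
theorem pauliWord_mulVec_tensorAcross (w : Fin N → Pauli) (a : ({i // i ∈ A} → Bool) → ℂ)
    (b : ({i // i ∉ A} → Bool) → ℂ) :
    pauliWord w *ᵥ tensorAcross A a b =
      tensorAcross A (pauliWordOn (fun i : {i // i ∈ A} => w i) *ᵥ a)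
        (pauliWordOn (fun i : {i // i ∉ A} => w i) *ᵥ b) := by
  let e := Equiv.piEquivPiSubtypeProd (fun i : Fin N => i ∈ A) (fun _ => Bool)
  have h1 : ∀ x, (e x).1 = restrictIn A x := fun x => rfl
  have h2 : ∀ x, (e x).2 = restrictOut A x := fun x => rfl
  funext y
  rw [tensorAcross_apply, Matrix.mulVec, Matrix.mulVec, Matrix.mulVec, dotProduct, dotProduct,
    dotProduct, Finset.sum_mul_sum, ← Fintype.sum_prod_type']
  refine Fintype.sum_equiv e _ _ fun x => ?_
  rw [tensorAcross_apply, pauliWord_apply, pauliWordOn_apply, pauliWordOn_apply, h1, h2]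
  simp only [restrictIn, restrictOut]
  rw [← Finset.prod_subtype A (fun _ => Iff.rfl) (fun j => (w j).mat (y j) (x j)),
    ← Finset.prod_subtype Aᶜ (fun _ => Finset.mem_compl) (fun j => (w j).mat (y j) (x j)),
    ← Finset.prod_mul_prod_compl A (fun j => (w j).mat (y j) (x j))]
  ring

variable {A}

/-- A word supported in `A` (identity outside `A`) restricts to the identity on `Ā`.
[cite: GuhneToth2009, §8.1] -/
theorem pauliWordOn_out_eq_one {w : Fin N → Pauli} (hw : ∀ j, j ∉ A → w j = Pauli.I) :
    pauliWordOn (fun i : {i // i ∉ A} => w i) = 1 := by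
  have : (fun i : {i // i ∉ A} => w i) = fun _ => Pauli.I := funext fun i => hw i i.2
  rw [this, pauliWordOn_const_I]

/-- A word supported in `Ā` (identity on `A`) restricts to the identity on `A`.
[cite: GuhneToth2009, §8.1] -/
theorem pauliWordOn_in_eq_one {w : Fin N → Pauli} (hw : ∀ j, j ∈ A → w j = Pauli.I) :
    pauliWordOn (fun i : {i // i ∈ A} => w i) = 1 := by
  have : (fun i : {i // i ∈ A} => w i) = fun _ => Pauli.I := funext fun i => hw i i.2
  rw [this, pauliWordOn_const_I]

section Factorisation

variable {a : ({i // i ∈ A} → Bool) → ℂ} {b : ({i // i ∉ A} → Bool) → ℂ}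

/-- **An operator on the unentangled block sees only that block**: for a word `V` supported in
`A` and unit `b`, `⟨a ⊗ b, V(a ⊗ b)⟩ = ⟨a, V_A a⟩` — independent of `b`.
[cite: GuhneToth2009, §8.1.2 eq. (196)] -/
theorem dot_word_in {v : Fin N → Pauli} (hv : ∀ j, j ∉ A → v j = Pauli.I)
    (hb : star b ⬝ᵥ b = 1) :
    star (tensorAcross A a b) ⬝ᵥ (pauliWord v *ᵥ tensorAcross A a b) =
      star a ⬝ᵥ (pauliWordOn (fun i : {i // i ∈ A} => v i) *ᵥ a) := by
  rw [pauliWord_mulVec_tensorAcross, pauliWordOn_out_eq_one hv, one_mulVec,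
    star_tensorAcross_dotProduct, hb, mul_one]

/-- Two words `V, V'` supported in `A`: `⟨a ⊗ b, V V'(a ⊗ b)⟩ = ⟨V_A a, V'_A a⟩` (unit `b`).
[cite: GuhneToth2009, §8.1.2 eq. (196)] -/
theorem dot_word_in_in {v v' : Fin N → Pauli} (hv : ∀ j, j ∉ A → v j = Pauli.I)
    (hv' : ∀ j, j ∉ A → v' j = Pauli.I) (hb : star b ⬝ᵥ b = 1) :
    star (tensorAcross A a b) ⬝ᵥ (pauliWord v *ᵥ (pauliWord v' *ᵥ tensorAcross A a b)) =
      star (pauliWordOn (fun i : {i // i ∈ A} => v i) *ᵥ a) ⬝ᵥ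
        (pauliWordOn (fun i : {i // i ∈ A} => v' i) *ᵥ a) := by
  rw [pauliWord_eq_pauliWordOn v, star_dotProduct_pauliWordOn_mulVec, ← pauliWord_eq_pauliWordOn,
    pauliWord_mulVec_tensorAcross, pauliWord_mulVec_tensorAcross, pauliWordOn_out_eq_one hv,
    pauliWordOn_out_eq_one hv', one_mulVec, star_tensorAcross_dotProduct, hb, mul_one]

/-- **Cross terms factorise**: for `V` supported in `A`, `W` supported in `Ā` and unit `a`, `b`,
`⟨a ⊗ b, V W (a ⊗ b)⟩ = ⟨a ⊗ b, V(a ⊗ b)⟩ · ⟨a ⊗ b, W(a ⊗ b)⟩` (no correlations across the cut in a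
product state). [cite: GuhneToth2009, §8.1.2 eq. (196)] -/
theorem dot_word_in_out {v w : Fin N → Pauli} (hv : ∀ j, j ∉ A → v j = Pauli.I)
    (hw : ∀ j, j ∈ A → w j = Pauli.I) (ha : star a ⬝ᵥ a = 1) (hb : star b ⬝ᵥ b = 1) :
    star (tensorAcross A a b) ⬝ᵥ (pauliWord v *ᵥ (pauliWord w *ᵥ tensorAcross A a b)) =
      (star (tensorAcross A a b) ⬝ᵥ (pauliWord v *ᵥ tensorAcross A a b)) *
        (star (tensorAcross A a b) ⬝ᵥ (pauliWord w *ᵥ tensorAcross A a b)) := by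
  rw [pauliWord_eq_pauliWordOn v, star_dotProduct_pauliWordOn_mulVec, ← pauliWord_eq_pauliWordOn,
    pauliWord_mulVec_tensorAcross, pauliWord_mulVec_tensorAcross,
    pauliWordOn_out_eq_one hv, pauliWordOn_in_eq_one hw, one_mulVec, one_mulVec,
    star_tensorAcross_dotProduct, star_tensorAcross_dotProduct, star_tensorAcross_dotProduct,
    ha, hb, one_mul, mul_one, ← star_dotProduct_pauliWordOn_mulVec]

/-- The same with the factors in the other order: `⟨a ⊗ b, W V (a ⊗ b)⟩ = ⟨V⟩·⟨W⟩`.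
[cite: GuhneToth2009, §8.1.2 eq. (196)] -/
theorem dot_word_out_in {v w : Fin N → Pauli} (hv : ∀ j, j ∉ A → v j = Pauli.I)
    (hw : ∀ j, j ∈ A → w j = Pauli.I) (ha : star a ⬝ᵥ a = 1) (hb : star b ⬝ᵥ b = 1) :
    star (tensorAcross A a b) ⬝ᵥ (pauliWord w *ᵥ (pauliWord v *ᵥ tensorAcross A a b)) =
      (star (tensorAcross A a b) ⬝ᵥ (pauliWord v *ᵥ tensorAcross A a b)) *
        (star (tensorAcross A a b) ⬝ᵥ (pauliWord w *ᵥ tensorAcross A a b)) := by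
  rw [pauliWord_eq_pauliWordOn w, star_dotProduct_pauliWordOn_mulVec, ← pauliWord_eq_pauliWordOn,
    pauliWord_mulVec_tensorAcross, pauliWord_mulVec_tensorAcross,
    pauliWordOn_out_eq_one hv, pauliWordOn_in_eq_one hw, one_mulVec, one_mulVec,
    star_tensorAcross_dotProduct, star_tensorAcross_dotProduct, star_tensorAcross_dotProduct,
    ha, hb, one_mul, mul_one, ← star_dotProduct_pauliWordOn_mulVec]

end Factorisation

end Cut

/-! ## States with an unentangled block `A`, and the two parts of the collective spin -/

section Block

/-- **A state with the spins of `A` unentangled from the rest**: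
`|Ψ⟩ = (⊗_{k ∈ A} |φ_k⟩) ⊗ |b⟩_{Ā}` — each qubit of `A` is in its own pure state, the remaining
qubits are in an arbitrary (entangled) joint state `b` (“Let us consider a pure state for which the
first `M` qubits are not entangled with other qubits while the rest of the qubits are entangled with
each other `|Ψ⟩ = (⊗_{k=1}^M |ψ_k⟩) ⊗ |ψ⟩_{M+1,…,N}`”; here the block is any `A` with `|A| = M`).
[cite: GuhneToth2009, §8.1.2 eq. (196)] -/
def blockState (A : Finset (Fin N)) (φ : Fin N → Bool → ℂ) (b : ({i // i ∉ A} → Bool) → ℂ) :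
    (Fin N → Bool) → ℂ :=
  tensorAcross A (fun u => ∏ i : {i // i ∈ A}, φ i (u i)) b

/-- The fully separable reference state with the same block: `productVec φ` is `blockState` with a
product also on `Ā`. [cite: GuhneToth2009, §8.1.2 (eq. (195): “all pure product states
saturate”)] -/
theorem productVec_eq_blockState (A : Finset (Fin N)) (φ : Fin N → Bool → ℂ) :
    productVec φ = blockState A φ (fun v => ∏ i : {i // i ∉ A}, φ i (v i)) :=
  productVec_eq_tensorAcross A φ

/-- The part of `2J_l` inside the block: `Σ_{i ∈ A} σ_l^{(i)}`. [cite: GuhneToth2009, §8.1.2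
eq. (196)] -/
def spinIn (A : Finset (Fin N)) (l : Pauli) : Matrix (Fin N → Bool) (Fin N → Bool) ℂ :=
  ∑ i ∈ A, localPauli l i

/-- The part of `2J_l` outside the block: `Σ_{i ∉ A} σ_l^{(i)}`. [cite: GuhneToth2009, §8.1.2
eq. (196)] -/
def spinOut (A : Finset (Fin N)) (l : Pauli) : Matrix (Fin N → Bool) (Fin N → Bool) ℂ :=
  ∑ i ∈ Aᶜ, localPauli l i

/-- `J_l = ½(Σ_{i∈A} σ_l^{(i)} + Σ_{i∉A} σ_l^{(i)})`. [cite: GuhneToth2009, §8.1 (“`J_l := Σ_k ½σ_l^{(k)}`”)] -/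
theorem collectiveSpin_eq (A : Finset (Fin N)) (l : Pauli) :
    collectiveSpin l N = ((1 : ℝ) / 2) • (spinIn A l + spinOut A l) := by
  rw [collectiveSpin, spinIn, spinOut, Finset.sum_add_sum_compl]

/-- Local Paulis are Hermitian. [cite: GuhneToth2009, §8.1] -/
theorem localPauli_isHermitian (l : Pauli) (i : Fin N) : (localPauli l i).IsHermitian :=
  pauliWord_isHermitian _

/-- `Σ_{i∈A} σ_l^{(i)}` is Hermitian. [cite: GuhneToth2009, §8.1] -/
theorem spinIn_isHermitian (A : Finset (Fin N)) (l : Pauli) : (spinIn A l).IsHermitian :=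
  (isSelfAdjoint_sum A fun i _ => (localPauli_isHermitian l i).isSelfAdjoint).isHermitian

/-- `Σ_{i∉A} σ_l^{(i)}` is Hermitian. [cite: GuhneToth2009, §8.1] -/
theorem spinOut_isHermitian (A : Finset (Fin N)) (l : Pauli) : (spinOut A l).IsHermitian :=
  (isSelfAdjoint_sum Aᶜ fun i _ => (localPauli_isHermitian l i).isSelfAdjoint).isHermitian

variable {A : Finset (Fin N)}

/-- The word of `σ_l^{(i)}`, `i ∈ A`, is supported in `A`. [cite: GuhneToth2009, §8.1] -/
theorem localWord_out {i : Fin N} (hi : i ∈ A) (l : Pauli) :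
    ∀ j, j ∉ A → Function.update (fun _ : Fin N => Pauli.I) i l j = Pauli.I := by
  intro j hj
  rw [Function.update_of_ne]
  rintro rfl
  exact hj hi

/-- The word of `σ_l^{(i)}`, `i ∉ A`, is supported in `Ā`. [cite: GuhneToth2009, §8.1] -/
theorem localWord_in {i : Fin N} (hi : i ∉ A) (l : Pauli) :
    ∀ j, j ∈ A → Function.update (fun _ : Fin N => Pauli.I) i l j = Pauli.I := by
  intro j hj
  rw [Function.update_of_ne]
  rintro rfl
  exact hi hj

end Block

/-! ## The variance of `J_l` in a block state: `(ΔJ_l)² = ¼Σ_{i∈A}(1 − l_i²) + ¼(ΔQ_l)²` -/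

section Main

variable {A : Finset (Fin N)} {φ : Fin N → Bool → ℂ} (hφ : ∀ i, star (φ i) ⬝ᵥ φ i = 1)
  {b : ({i // i ∉ A} → Bool) → ℂ} (hb : star b ⬝ᵥ b = 1)
include hφ

/-- The block factor `⊗_{i∈A} φ_i` is a unit vector. [cite: GuhneToth2009, §8.1.2 eq. (196)] -/
theorem blockIn_norm :
    star (fun u : {i // i ∈ A} → Bool => ∏ i : {i // i ∈ A}, φ i (u i)) ⬝ᵥ
      (fun u => ∏ i : {i // i ∈ A}, φ i (u i)) = 1 := by
  rw [star_prodVec_dotProduct]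
  exact Finset.prod_eq_one fun i _ => hφ i

/-- The reference factor `⊗_{i∉A} φ_i` is a unit vector. [cite: GuhneToth2009, §8.1.2 eq. (196)] -/
theorem blockOut_norm :
    star (fun v : {i // i ∉ A} → Bool => ∏ i : {i // i ∉ A}, φ i (v i)) ⬝ᵥ
      (fun v => ∏ i : {i // i ∉ A}, φ i (v i)) = 1 := by
  rw [star_prodVec_dotProduct]
  exact Finset.prod_eq_one fun i _ => hφ i

include hb

/-- A block state is a unit vector. [cite: GuhneToth2009, §8.1.2 eq. (196)] -/
theorem blockState_norm : star (blockState A φ b) ⬝ᵥ blockState A φ b = 1 := by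
  rw [blockState, star_tensorAcross_dotProduct, blockIn_norm hφ, hb, mul_one]

/-- **The block part does not feel `b`**: `⟨Σ_{i∈A}σ_l^{(i)}⟩_Ψ = ⟨Σ_{i∈A}σ_l^{(i)}⟩_{⊗φ}`
(the expectation in the block state equals that in the fully separable reference state).
[cite: GuhneToth2009, §8.1.2 eq. (196)] -/
theorem dot_spinIn_eq (l : Pauli) :
    star (blockState A φ b) ⬝ᵥ (spinIn A l *ᵥ blockState A φ b) =
      star (productVec φ) ⬝ᵥ (spinIn A l *ᵥ productVec φ) := by
  rw [productVec_eq_blockState A φ, blockState, blockState, spinIn, Matrix.sum_mulVec,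
    Matrix.sum_mulVec, dotProduct_sum, dotProduct_sum]
  refine Finset.sum_congr rfl fun i hi => ?_
  rw [localPauli, dot_word_in (localWord_out hi l) hb,
    dot_word_in (localWord_out hi l) (blockOut_norm hφ)]

/-- The same for the square: `⟨(Σ_{i∈A}σ_l^{(i)})²⟩_Ψ = ⟨(Σ_{i∈A}σ_l^{(i)})²⟩_{⊗φ}`.
[cite: GuhneToth2009, §8.1.2 eq. (196)] -/
theorem dot_spinIn_sq_eq (l : Pauli) :
    star (blockState A φ b) ⬝ᵥ (spinIn A l *ᵥ (spinIn A l *ᵥ blockState A φ b)) =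
      star (productVec φ) ⬝ᵥ (spinIn A l *ᵥ (spinIn A l *ᵥ productVec φ)) := by
  rw [productVec_eq_blockState A φ, blockState, blockState, spinIn]
  simp_rw [Matrix.sum_mulVec, Matrix.mulVec_sum, dotProduct_sum]
  refine Finset.sum_congr rfl fun i hi => Finset.sum_congr rfl fun j hj => ?_
  rw [localPauli, localPauli, dot_word_in_in (localWord_out hi l) (localWord_out hj l) hb,
    dot_word_in_in (localWord_out hi l) (localWord_out hj l) (blockOut_norm hφ)]

/-- **No correlations across the cut**: `⟨P Q⟩_Ψ = ⟨P⟩_Ψ ⟨Q⟩_Ψ` for `P = Σ_{i∈A}σ_l^{(i)}`,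
`Q = Σ_{i∉A}σ_l^{(i)}`. [cite: GuhneToth2009, §8.1.2 eq. (196)] -/
theorem dot_spinIn_spinOut (l : Pauli) :
    star (blockState A φ b) ⬝ᵥ (spinIn A l *ᵥ (spinOut A l *ᵥ blockState A φ b)) =
      (star (blockState A φ b) ⬝ᵥ (spinIn A l *ᵥ blockState A φ b)) *
        (star (blockState A φ b) ⬝ᵥ (spinOut A l *ᵥ blockState A φ b)) := by
  rw [spinIn, spinOut]
  simp_rw [Matrix.sum_mulVec, Matrix.mulVec_sum, dotProduct_sum]
  rw [Finset.sum_mul_sum]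
  refine Finset.sum_congr rfl fun i hi => Finset.sum_congr rfl fun j hj => ?_
  rw [Finset.mem_compl] at hj
  rw [localPauli, localPauli, blockState]
  exact dot_word_in_out (localWord_out hi l) (localWord_in hj l) (blockIn_norm hφ) hb

/-- The other order: `⟨Q P⟩_Ψ = ⟨P⟩_Ψ ⟨Q⟩_Ψ`. [cite: GuhneToth2009, §8.1.2 eq. (196)] -/
theorem dot_spinOut_spinIn (l : Pauli) :
    star (blockState A φ b) ⬝ᵥ (spinOut A l *ᵥ (spinIn A l *ᵥ blockState A φ b)) =
      (star (blockState A φ b) ⬝ᵥ (spinIn A l *ᵥ blockState A φ b)) *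
        (star (blockState A φ b) ⬝ᵥ (spinOut A l *ᵥ blockState A φ b)) := by
  rw [spinIn, spinOut]
  simp_rw [Matrix.sum_mulVec, Matrix.mulVec_sum, dotProduct_sum]
  rw [Finset.sum_mul_sum, Finset.sum_comm]
  refine Finset.sum_congr rfl fun i hi => Finset.sum_congr rfl fun j hj => ?_
  rw [Finset.mem_compl] at hj
  rw [localPauli, localPauli, blockState]
  exact dot_word_out_in (localWord_out hi l) (localWord_in hj l) (blockIn_norm hφ) hb

omit hb in
/-- In the reference product state: `⟨Σ_{i∈A}σ_l^{(i)}⟩ = Σ_{i∈A} l_i` (`l_i = ⟨φ_i|σ_l|φ_i⟩`).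
[cite: GuhneToth2009, §8.1 (product-state expectations)] -/
theorem vecState_spinIn_productVec (l : Pauli) :
    vecState (productVec φ) (spinIn A l) = ∑ i ∈ A, bloch l (φ i) := by
  rw [spinIn, map_sum]
  exact Finset.sum_congr rfl fun i _ => expect_localPauli φ hφ l i

omit hb in
/-- In the reference product state: `⟨(Σ_{i∈A}σ_l^{(i)})²⟩ = |A| + (Σ_{i∈A} l_i)² − Σ_{i∈A} l_i²`.
[cite: GuhneToth2009, §8.1 (product-state expectations)] -/
theorem vecState_spinIn_sq_productVec (l : Pauli) :
    vecState (productVec φ) (spinIn A l * spinIn A l) =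
      A.card + (∑ i ∈ A, bloch l (φ i)) ^ 2 - ∑ i ∈ A, bloch l (φ i) ^ 2 := by
  rw [spinIn, Finset.sum_mul_sum, map_sum]
  simp_rw [map_sum, expect_localPauli_mul φ hφ l]
  have h : ∀ i ∈ A, ∑ j ∈ A, (if i = j then (1 : ℝ) else bloch l (φ i) * bloch l (φ j)) =
      1 + (bloch l (φ i) * ∑ j ∈ A, bloch l (φ j) - bloch l (φ i) ^ 2) := by
    intro i hi
    have e : ∀ j, (if i = j then (1 : ℝ) else bloch l (φ i) * bloch l (φ j)) =
        bloch l (φ i) * bloch l (φ j) + (if i = j then 1 - bloch l (φ i) ^ 2 else 0) := by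
      intro j
      split_ifs with h
      · subst h; ring
      · ring
    simp_rw [e]
    rw [Finset.sum_add_distrib, Finset.sum_ite_eq, if_pos hi, ← Finset.mul_sum]
    ring
  rw [Finset.sum_congr rfl h, Finset.sum_add_distrib, Finset.sum_sub_distrib, Finset.sum_const,
    ← Finset.sum_mul, nsmul_eq_mul, mul_one]
  ring

/-- **The LUR decomposition of the variance** (the step “based on the theory of entanglement
detection with uncertainties”): in a block state,
`(ΔJ_l)² = ¼·Σ_{i∈A}(1 − l_i²) + ¼·[⟨Q_l²⟩ − ⟨Q_l⟩²]` with `Q_l = Σ_{i∉A}σ_l^{(i)}` — the block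
contributes its single-qubit variances, the rest its own variance, and the cross terms cancel.
[cite: GuhneToth2009, §8.1.2 eq. (196) (with [108], [502], [504])] -/
theorem variance_collectiveSpin_blockState (l : Pauli) :
    variance (blockState A φ b) (collectiveSpin l N) =
      1 / 4 * ∑ i ∈ A, (1 - bloch l (φ i) ^ 2) +
        1 / 4 * (vecState (blockState A φ b) (spinOut A l * spinOut A l) -
          vecState (blockState A φ b) (spinOut A l) ^ 2) := by
  set ψ := blockState A φ b with hψ
  -- the complex expectations
  set P := spinIn A l
  set Q := spinOut A l
  have hP : star ψ ⬝ᵥ (P *ᵥ ψ) = ((vecState ψ P : ℝ) : ℂ) :=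
    star_dotProduct_mulVec_of_isHermitian (spinIn_isHermitian A l) ψ
  have hQ : star ψ ⬝ᵥ (Q *ᵥ ψ) = ((vecState ψ Q : ℝ) : ℂ) :=
    star_dotProduct_mulVec_of_isHermitian (spinOut_isHermitian A l) ψ
  have hPQ : vecState ψ (P * Q) = vecState ψ P * vecState ψ Q := by
    rw [vecState_apply ψ (P * Q), ← mulVec_mulVec, hψ, dot_spinIn_spinOut hφ hb l, ← hψ, hP, hQ,
      ← Complex.ofReal_mul, Complex.ofReal_re]
  have hQP : vecState ψ (Q * P) = vecState ψ P * vecState ψ Q := by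
    rw [vecState_apply ψ (Q * P), ← mulVec_mulVec, hψ, dot_spinOut_spinIn hφ hb l, ← hψ, hP, hQ,
      ← Complex.ofReal_mul, Complex.ofReal_re]
  have hP0 : vecState ψ P = ∑ i ∈ A, bloch l (φ i) := by
    rw [vecState_apply, hψ, dot_spinIn_eq hφ hb l, ← vecState_apply, vecState_spinIn_productVec hφ]
  have hPP : vecState ψ (P * P) = A.card + (∑ i ∈ A, bloch l (φ i)) ^ 2 - ∑ i ∈ A, bloch l (φ i) ^ 2 := by
    rw [vecState_apply, ← mulVec_mulVec, hψ, dot_spinIn_sq_eq hφ hb l, mulVec_mulVec,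
      ← vecState_apply, vecState_spinIn_sq_productVec hφ]
  rw [variance, collectiveSpin_eq A, smul_mul_assoc, mul_smul_comm, smul_smul, map_smul, map_smul,
    smul_eq_mul, smul_eq_mul, add_mul, mul_add, mul_add, map_add, map_add, map_add, map_add,
    hPQ, hQP, hPP, hP0, Finset.sum_sub_distrib, Finset.sum_const, nsmul_eq_mul, mul_one]
  ring

/-- The variance of the rest is non-negative: `⟨Q_l²⟩ − ⟨Q_l⟩² ≥ 0` (a vector state is a positive
functional; `Q_l` is Hermitian). [cite: GuhneToth2009, §8.1 (“the variances `(ΔJ_k)²`”)] -/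
theorem varianceOut_nonneg (l : Pauli) :
    0 ≤ vecState (blockState A φ b) (spinOut A l * spinOut A l) -
      vecState (blockState A φ b) (spinOut A l) ^ 2 := by
  have h := (isPosFunctional_vecState (blockState A φ b)).sq_le_one_mul
    (spinOut_isHermitian A l).isSelfAdjoint
  rw [vecState_one, blockState_norm hφ hb, Complex.one_re, one_mul] at h
  linarith

/-- **Eq. (196) for one component**: `(ΔJ_l)² ≥ ¼Σ_{i∈A}(1 − l_i²)` in a block state.
[cite: GuhneToth2009, §8.1.2 eq. (196)] -/
theorem variance_collectiveSpin_blockState_ge (l : Pauli) :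
    1 / 4 * ∑ i ∈ A, (1 - bloch l (φ i) ^ 2) ≤ variance (blockState A φ b) (collectiveSpin l N) := by
  rw [variance_collectiveSpin_blockState hφ hb]
  have := varianceOut_nonneg hφ hb l
  linarith

/-- **Gühne–Tóth (196), pure states**: if the `|A|` spins of `A` are unentangled from the rest
(`|Ψ⟩ = (⊗_{k∈A}|φ_k⟩) ⊗ |b⟩_Ā`), then `(ΔJ_x)² + (ΔJ_y)² + (ΔJ_z)² ≥ |A|/2`.
[cite: GuhneToth2009, §8.1.2 eq. (196)] -/
theorem sum_variance_blockState_ge :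
    (A.card : ℝ) / 2 ≤ variance (blockState A φ b) (collectiveSpin Pauli.X N) +
      variance (blockState A φ b) (collectiveSpin Pauli.Y N) +
      variance (blockState A φ b) (collectiveSpin Pauli.Z N) := by
  have hx := variance_collectiveSpin_blockState_ge hφ hb Pauli.X
  have hy := variance_collectiveSpin_blockState_ge hφ hb Pauli.Y
  have hz := variance_collectiveSpin_blockState_ge hφ hb Pauli.Z
  have h : ∀ i, (1 - bloch Pauli.X (φ i) ^ 2) + (1 - bloch Pauli.Y (φ i) ^ 2) +
      (1 - bloch Pauli.Z (φ i) ^ 2) = 2 := fun i => by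
    have := bloch_sq_sum (φ i) (hφ i); linarith
  have hs : ∑ i ∈ A, (1 - bloch Pauli.X (φ i) ^ 2) + ∑ i ∈ A, (1 - bloch Pauli.Y (φ i) ^ 2) +
      ∑ i ∈ A, (1 - bloch Pauli.Z (φ i) ^ 2) = 2 * (A.card : ℝ) := by
    rw [← Finset.sum_add_distrib, ← Finset.sum_add_distrib]
    simp_rw [h]
    rw [Finset.sum_const, nsmul_eq_mul, mul_comm]
  linarith

/-- **The exact excess** (the LUR identity behind (196)): `Σ_l (ΔJ_l)² = |A|/2 + ¼Σ_l (ΔQ_l)²`,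
`Q_l = Σ_{i∉A} σ_l^{(i)}` — the inequality (196) is saturated exactly when the rest has no
collective-spin variance. [cite: GuhneToth2009, §8.1.2 eqs. (195)–(196)] -/
theorem sum_variance_blockState_eq :
    variance (blockState A φ b) (collectiveSpin Pauli.X N) +
        variance (blockState A φ b) (collectiveSpin Pauli.Y N) +
        variance (blockState A φ b) (collectiveSpin Pauli.Z N) =
      (A.card : ℝ) / 2 + 1 / 4 *
        ((vecState (blockState A φ b) (spinOut A Pauli.X * spinOut A Pauli.X) -
            vecState (blockState A φ b) (spinOut A Pauli.X) ^ 2) +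
          (vecState (blockState A φ b) (spinOut A Pauli.Y * spinOut A Pauli.Y) -
            vecState (blockState A φ b) (spinOut A Pauli.Y) ^ 2) +
          (vecState (blockState A φ b) (spinOut A Pauli.Z * spinOut A Pauli.Z) -
            vecState (blockState A φ b) (spinOut A Pauli.Z) ^ 2)) := by
  rw [variance_collectiveSpin_blockState hφ hb, variance_collectiveSpin_blockState hφ hb,
    variance_collectiveSpin_blockState hφ hb]
  have h : ∀ i, (1 - bloch Pauli.X (φ i) ^ 2) + (1 - bloch Pauli.Y (φ i) ^ 2) +
      (1 - bloch Pauli.Z (φ i) ^ 2) = 2 := fun i => by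
    have := bloch_sq_sum (φ i) (hφ i); linarith
  have hs : ∑ i ∈ A, (1 - bloch Pauli.X (φ i) ^ 2) + ∑ i ∈ A, (1 - bloch Pauli.Y (φ i) ^ 2) +
      ∑ i ∈ A, (1 - bloch Pauli.Z (φ i) ^ 2) = 2 * (A.card : ℝ) := by
    rw [← Finset.sum_add_distrib, ← Finset.sum_add_distrib]
    simp_rw [h]
    rw [Finset.sum_const, nsmul_eq_mul, mul_comm]
  linarith

end Main

/-! ## Mixed states: mixtures of states with `≥ M` unentangled spins -/

/-- `ψ` **has the block `A` unentangled**: `ψ = (⊗_{k∈A}|φ_k⟩) ⊗ |b⟩_Ā` with unit factors.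
[cite: GuhneToth2009, §8.1.2 eq. (196)] -/
def HasUnentangledBlock (A : Finset (Fin N)) (ψ : (Fin N → Bool) → ℂ) : Prop :=
  ∃ (φ : Fin N → Bool → ℂ) (b : ({i // i ∉ A} → Bool) → ℂ),
    (∀ i, star (φ i) ⬝ᵥ φ i = 1) ∧ star b ⬝ᵥ b = 1 ∧ ψ = blockState A φ b

/-- (196) restated for `HasUnentangledBlock`. [cite: GuhneToth2009, §8.1.2 eq. (196)] -/
theorem HasUnentangledBlock.sum_variance_ge {A : Finset (Fin N)} {ψ : (Fin N → Bool) → ℂ}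
    (h : HasUnentangledBlock A ψ) :
    (A.card : ℝ) / 2 ≤ variance ψ (collectiveSpin Pauli.X N) + variance ψ (collectiveSpin Pauli.Y N) +
      variance ψ (collectiveSpin Pauli.Z N) := by
  obtain ⟨φ, b, hφ, hb, rfl⟩ := h
  exact sum_variance_blockState_ge hφ hb

/-- **Gühne–Tóth (196), mixtures** (Tóth 2005: “For mixed states of the form
`ρ = Σ_k p_k|Φ_k⟩⟨Φ_k|` we obtain `⟨H_S⟩/2 ≥ Σ_k p_k N_{u,k}`”): if `ϱ = Σ_k p_k|Ψ_k⟩⟨Ψ_k|` and the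
`k`-th component has the block `A_k` unentangled, then `Σ_l (ΔJ_l)²_ϱ ≥ Σ_k p_k |A_k|/2`
(concavity of the variance). [cite: GuhneToth2009, §8.1.2 eq. (196) and the sentence after it;
Toth2005SpinModelWitnesses, the paragraph on `H_S = J_x² + J_y² + J_z²` (“`⟨H_S⟩/2 ≥ Σ_k p_k N_{u,k}`”)] -/
theorem sum_varianceT_mixture_ge {ι : Type*} [Fintype ι] (p : ι → ℝ) (hp : ∀ k, 0 ≤ p k)
    (h1 : ∑ k, p k = 1) (ψ : ι → (Fin N → Bool) → ℂ) (Ak : ι → Finset (Fin N))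
    (hψ : ∀ k, HasUnentangledBlock (Ak k) (ψ k)) :
    ∑ k, p k * (((Ak k).card : ℝ) / 2) ≤
      varianceT (∑ k, (p k : ℂ) • vecMulVec (ψ k) (star (ψ k))) (collectiveSpin Pauli.X N) +
        varianceT (∑ k, (p k : ℂ) • vecMulVec (ψ k) (star (ψ k))) (collectiveSpin Pauli.Y N) +
        varianceT (∑ k, (p k : ℂ) • vecMulVec (ψ k) (star (ψ k))) (collectiveSpin Pauli.Z N) := by
  have hx := varianceT_mixture_ge p hp h1 ψ (collectiveSpin Pauli.X N)
  have hy := varianceT_mixture_ge p hp h1 ψ (collectiveSpin Pauli.Y N)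
  have hz := varianceT_mixture_ge p hp h1 ψ (collectiveSpin Pauli.Z N)
  have hk : ∑ k, p k * (((Ak k).card : ℝ) / 2) ≤
      ∑ k, p k * variance (ψ k) (collectiveSpin Pauli.X N) +
        ∑ k, p k * variance (ψ k) (collectiveSpin Pauli.Y N) +
        ∑ k, p k * variance (ψ k) (collectiveSpin Pauli.Z N) := by
    rw [← Finset.sum_add_distrib, ← Finset.sum_add_distrib]
    refine Finset.sum_le_sum fun k _ => ?_
    rw [← mul_add, ← mul_add]
    exact mul_le_mul_of_nonneg_left ((hψ k).sum_variance_ge) (hp k)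
  linarith

/-- **(196) for mixtures with `≥ M` unentangled spins in every component**: then
`Σ_l (ΔJ_l)²_ϱ ≥ M/2`. [cite: GuhneToth2009, §8.1.2 (“If a mixed state `ϱ := Σ_k p_k|Ψ_k⟩⟨Ψ_k|`
violates Eq. (196) then at least one of the components … must have …”)] -/
theorem sum_varianceT_mixture_ge_of_card {ι : Type*} [Fintype ι] (p : ι → ℝ) (hp : ∀ k, 0 ≤ p k)
    (h1 : ∑ k, p k = 1) (ψ : ι → (Fin N → Bool) → ℂ) (Ak : ι → Finset (Fin N))
    (hψ : ∀ k, HasUnentangledBlock (Ak k) (ψ k)) (M : ℕ) (hM : ∀ k, M ≤ (Ak k).card) :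
    (M : ℝ) / 2 ≤
      varianceT (∑ k, (p k : ℂ) • vecMulVec (ψ k) (star (ψ k))) (collectiveSpin Pauli.X N) +
        varianceT (∑ k, (p k : ℂ) • vecMulVec (ψ k) (star (ψ k))) (collectiveSpin Pauli.Y N) +
        varianceT (∑ k, (p k : ℂ) • vecMulVec (ψ k) (star (ψ k))) (collectiveSpin Pauli.Z N) := by
  refine le_trans ?_ (sum_varianceT_mixture_ge p hp h1 ψ Ak hψ)
  calc (M : ℝ) / 2 = ∑ k, p k * ((M : ℝ) / 2) := by rw [← Finset.sum_mul, h1, one_mul]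
    _ ≤ ∑ k, p k * (((Ak k).card : ℝ) / 2) :=
        Finset.sum_le_sum fun k _ => mul_le_mul_of_nonneg_left
          (by have : (M : ℝ) ≤ (Ak k).card := by exact_mod_cast hM k
              linarith) (hp k)

/-- **Violation certifies the absence of unentangled spins** (“If the left-hand side of Eq. (196)
is smaller than `1/2` then the state cannot be created by mixing states that have one or more
unentangled spins”; general `M`): if `Σ_l (ΔJ_l)²_ϱ < M/2`, then in every decomposition
`ϱ = Σ_k p_k|Ψ_k⟩⟨Ψ_k|` into states with unentangled blocks, some component with `p_k > 0` has a
block of fewer than `M` spins. [cite: GuhneToth2009, §8.1.2 (after eq. (196))] -/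
theorem exists_block_lt_of_sum_varianceT_lt {ι : Type*} [Fintype ι] (p : ι → ℝ)
    (hp : ∀ k, 0 ≤ p k) (h1 : ∑ k, p k = 1) (ψ : ι → (Fin N → Bool) → ℂ)
    (Ak : ι → Finset (Fin N)) (hψ : ∀ k, HasUnentangledBlock (Ak k) (ψ k)) (M : ℕ)
    (hlt : varianceT (∑ k, (p k : ℂ) • vecMulVec (ψ k) (star (ψ k))) (collectiveSpin Pauli.X N) +
        varianceT (∑ k, (p k : ℂ) • vecMulVec (ψ k) (star (ψ k))) (collectiveSpin Pauli.Y N) +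
        varianceT (∑ k, (p k : ℂ) • vecMulVec (ψ k) (star (ψ k))) (collectiveSpin Pauli.Z N) <
      (M : ℝ) / 2) :
    ∃ k, 0 < p k ∧ (Ak k).card < M := by
  by_contra hcon
  push Not at hcon
  have hge := sum_varianceT_mixture_ge p hp h1 ψ Ak hψ
  -- every component with positive weight has `|A_k| ≥ M`
  have hk : (M : ℝ) / 2 ≤ ∑ k, p k * (((Ak k).card : ℝ) / 2) := by
    calc (M : ℝ) / 2 = ∑ k, p k * ((M : ℝ) / 2) := by rw [← Finset.sum_mul, h1, one_mul]
      _ ≤ ∑ k, p k * (((Ak k).card : ℝ) / 2) := by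
          refine Finset.sum_le_sum fun k _ => ?_
          rcases (hp k).eq_or_lt with h0 | hpos
          · rw [← h0]; simp
          · have hMk : (M : ℝ) ≤ (Ak k).card := by exact_mod_cast hcon k hpos
            exact mul_le_mul_of_nonneg_left (by linarith) (hp k)
  linarith

end UnentangledSpins

end Literature.InformationTheory.Entanglement
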